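import Mathlib
import Summits.Ventures.HodgeRepro2.Tier7.Line3.HyperbolicLatticeCount

/-!
# Tier 7 — LINE 3 support: the SHARP count for the modular group, `β = 1`
(`Line3/ModularGroupCount.lean`; t7-L1-p1, gen 2; Mathlib + Line3/HyperbolicLatticeCount)

`Line3/HyperbolicLatticeCount.count_SL2Z` counts `SL(2, ℤ)` in the cosh-size by the plain box, `β = 2`. The classical
fibre argument gives the sharp exponent: for a fixed bottom row `(c, d)` (coprime, since `ad − bc = 1`) the solutions
`(a, b)` of `ad − bc = 1` form ONE arithmetic progression `(a₀ + tc, b₀ + td)`, `t ∈ ℤ` (`c ∣ a − a₀` by coprimality), and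
`a² + b² ≤ X` confines `t` to `|t| ≤ 2√X / √(c² + d²)` (`fibre_card_le`); summing over `0 < c² + d² ≤ X` with the sup-norm
shells (`#{max(|c|, |d|) = m} ≤ 8m`, `1/√(c² + d²) ≤ 1/m`: `sum_inv_sqrt_le`) gives
  `#{γ ∈ SL(2, ℤ) : a² + b² + c² + d² ≤ X} ≤ 38 (1 + X)` (`card_le_of_sq_le`),
hence `#{γ : κ γ ≤ R} ≤ 76 (1 + R)` (`count_SL2Z_sharp`, `β = 1`) and the Poincaré-series kernel of `SL(2, ℤ)` is continuous
for EVERY decay exponent `α > 1` (`continuous_kernelSum_SL2Z'`) — in particular for the weight-3 discrete-series coefficient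
(`α = 3/2`), the real-instance analogue of the memo's route (R1) (`β = 1 + ε`, weight 3), not only of (R2).

Nothing about `U(W_A)(F)` or the real test function (TYPING-CENSUS T7). Sorry-free; axioms trio. §8(d): NO.
-/

namespace Summit.Ventures.HodgeRepro2.Tier7.Line3.ModularGroupCount

open UpperHalfPlane HyperbolicSize HyperbolicLatticeCount Finset
open scoped MatrixGroups

/-! ## 1. The fibre over a bottom row: one arithmetic progression -/

/-- the integer square `[−M, M]²`. -/
noncomputable def sq (M : ℕ) : Finset (ℤ × ℤ) := (Icc (-(M : ℤ)) M) ×ˢ (Icc (-(M : ℤ)) M)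

/-- `#sq M = (2M + 1)²`. -/
theorem card_sq (M : ℕ) : (sq M).card = (2 * M + 1) ^ 2 := by
  simp only [sq, card_product, Int.card_Icc]
  have h : ((M : ℤ) + 1 - -(M : ℤ)).toNat = 2 * M + 1 := by omega
  rw [h]; ring

/-- membership in the square from the entry bounds. -/
theorem mem_sq {M : ℕ} {p : ℤ × ℤ} (h1 : p.1.natAbs ≤ M) (h2 : p.2.natAbs ≤ M) : p ∈ sq M := by
  simp only [sq, mem_product, mem_Icc]; omega

/-- `|x| ≤ ⌊√X⌋₊` for an integer `x` with `x² ≤ X`. -/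
theorem natAbs_le_floor_sqrt {x : ℤ} {X : ℝ} (h : ((x : ℤ) : ℝ) ^ 2 ≤ X) : x.natAbs ≤ ⌊Real.sqrt X⌋₊ := by
  apply Nat.le_floor
  rw [Nat.cast_natAbs, Int.cast_abs]
  exact Real.abs_le_sqrt h

/-- the fibre over the bottom row `(c, d)`: `(a, b)` with `ad − bc = 1` and `a² + b² ≤ X`. -/
noncomputable def fibre (X : ℝ) (c d : ℤ) : Finset (ℤ × ℤ) :=
  (sq ⌊Real.sqrt X⌋₊).filter (fun p => p.1 * d - p.2 * c = 1 ∧ ((p.1 : ℤ) : ℝ) ^ 2 + ((p.2 : ℤ) : ℝ) ^ 2 ≤ X)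

/-- membership in the fibre. -/
theorem mem_fibre {X : ℝ} {c d : ℤ} {p : ℤ × ℤ} :
    p ∈ fibre X c d ↔ p.1 * d - p.2 * c = 1 ∧ ((p.1 : ℤ) : ℝ) ^ 2 + ((p.2 : ℤ) : ℝ) ^ 2 ≤ X := by
  constructor
  · intro h; exact (mem_filter.1 h).2
  · intro h
    refine mem_filter.2 ⟨mem_sq ?_ ?_, h⟩
    · exact natAbs_le_floor_sqrt (by nlinarith [sq_nonneg ((p.2 : ℤ) : ℝ), h.2])
    · exact natAbs_le_floor_sqrt (by nlinarith [sq_nonneg ((p.1 : ℤ) : ℝ), h.2])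

/-- the progression parameter of a fibre point relative to a base point `(a₀, b₀)`. -/
def tOf (c d a₀ b₀ : ℤ) (p : ℤ × ℤ) : ℤ := if c ≠ 0 then (p.1 - a₀) / c else (p.2 - b₀) / d

/-- **one progression**: two solutions of `ad − bc = 1` differ by a multiple of `(c, d)`. -/
theorem eq_progression {c d a₀ b₀ : ℤ} (h₀ : a₀ * d - b₀ * c = 1) {p : ℤ × ℤ} (hp : p.1 * d - p.2 * c = 1) :
    p.1 - a₀ = tOf c d a₀ b₀ p * c ∧ p.2 - b₀ = tOf c d a₀ b₀ p * d := by
  have hrel : (p.1 - a₀) * d = (p.2 - b₀) * c := by linear_combination hp - h₀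
  have hcop : IsCoprime c d := ⟨-b₀, a₀, by linear_combination h₀⟩
  unfold tOf
  by_cases hc : c ≠ 0
  · rw [if_pos hc]
    have hdvd : c ∣ (p.1 - a₀) :=
      hcop.dvd_of_dvd_mul_right ⟨p.2 - b₀, by rw [hrel]; ring⟩
    have h1 : (p.1 - a₀) / c * c = p.1 - a₀ := Int.ediv_mul_cancel hdvd
    refine ⟨h1.symm, ?_⟩
    have h2 : (p.2 - b₀) * c = ((p.1 - a₀) / c * d) * c := by
      rw [mul_comm ((p.1 - a₀) / c) d, mul_assoc, h1, ← hrel]; ring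
    exact (mul_right_cancel₀ hc h2).symm.trans (by ring) |>.symm.trans (by ring)
  · have hc0 : c = 0 := not_not.mp hc
    rw [if_neg hc]
    subst hc0
    have hd : a₀ * d = 1 := by linarith
    have hdvd : d ∣ (p.2 - b₀) := ⟨a₀ * (p.2 - b₀), by linear_combination (-(p.2 - b₀)) * hd⟩
    have h2 : (p.2 - b₀) / d * d = p.2 - b₀ := Int.ediv_mul_cancel hdvd
    refine ⟨?_, h2.symm⟩
    have hd0 : d ≠ 0 := by rintro rfl; simp at hd
    have : (p.1 - a₀) * d = 0 := by rw [hrel]; ring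
    rcases mul_eq_zero.1 this with h | h
    · rw [h]; ring
    · exact absurd h hd0

/-- `t² (c² + d²) ≤ 4X` for two fibre points. -/
theorem tOf_sq_le {X : ℝ} {c d a₀ b₀ : ℤ} (h₀ : (a₀, b₀) ∈ fibre X c d) {p : ℤ × ℤ} (hp : p ∈ fibre X c d) :
    ((tOf c d a₀ b₀ p : ℤ) : ℝ) ^ 2 * (((c : ℤ) : ℝ) ^ 2 + ((d : ℤ) : ℝ) ^ 2) ≤ 4 * X := by
  obtain ⟨h₀eq, h₀le⟩ := mem_fibre.1 h₀
  obtain ⟨hpeq, hple⟩ := mem_fibre.1 hp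
  obtain ⟨ha, hb⟩ := eq_progression (c := c) (d := d) h₀eq hpeq
  have ha' : ((p.1 : ℤ) : ℝ) - a₀ = (tOf c d a₀ b₀ p : ℝ) * c := by exact_mod_cast ha
  have hb' : ((p.2 : ℤ) : ℝ) - b₀ = (tOf c d a₀ b₀ p : ℝ) * d := by exact_mod_cast hb
  have key : ((tOf c d a₀ b₀ p : ℤ) : ℝ) ^ 2 * (((c : ℤ) : ℝ) ^ 2 + ((d : ℤ) : ℝ) ^ 2) =
      (((p.1 : ℤ) : ℝ) - a₀) ^ 2 + (((p.2 : ℤ) : ℝ) - b₀) ^ 2 := by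
    rw [ha', hb']; ring
  rw [key]
  nlinarith [sq_nonneg (((p.1 : ℤ) : ℝ) + a₀), sq_nonneg (((p.2 : ℤ) : ℝ) + b₀)]

/-- the bound `|t| ≤ ⌊2√X / √(c² + d²)⌋₊`. -/
theorem natAbs_tOf_le {X : ℝ} (hX : 0 ≤ X) {c d a₀ b₀ : ℤ} (hcd : (c, d) ≠ (0, 0))
    (h₀ : (a₀, b₀) ∈ fibre X c d) {p : ℤ × ℤ} (hp : p ∈ fibre X c d) :
    (tOf c d a₀ b₀ p).natAbs ≤ ⌊2 * Real.sqrt X / Real.sqrt (((c : ℤ) : ℝ) ^ 2 + ((d : ℤ) : ℝ) ^ 2)⌋₊ := by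
  have hs : 0 < ((c : ℤ) : ℝ) ^ 2 + ((d : ℤ) : ℝ) ^ 2 := by
    rcases ne_or_eq c 0 with hc | hc
    · have : (0 : ℝ) < ((c : ℤ) : ℝ) ^ 2 := by positivity
      nlinarith [sq_nonneg ((d : ℤ) : ℝ)]
    · subst hc
      have hd : d ≠ 0 := by rintro rfl; exact hcd rfl
      have : (0 : ℝ) < ((d : ℤ) : ℝ) ^ 2 := by positivity
      simp only [Int.cast_zero, ne_eq, OfNat.ofNat_ne_zero, not_false_eq_true, zero_pow, zero_add]
      exact this
  have hsq := tOf_sq_le h₀ hp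
  apply Nat.le_floor
  rw [Nat.cast_natAbs, Int.cast_abs]
  -- `|t| ≤ 2√X/√s ⟸ |t|² ≤ 4X/s`
  rw [le_div_iff₀ (Real.sqrt_pos.2 hs)]
  have h1 : (|((tOf c d a₀ b₀ p : ℤ) : ℝ)| * Real.sqrt (((c : ℤ) : ℝ) ^ 2 + ((d : ℤ) : ℝ) ^ 2)) ^ 2 ≤
      (2 * Real.sqrt X) ^ 2 := by
    rw [mul_pow, sq_abs, Real.sq_sqrt hs.le, mul_pow, Real.sq_sqrt hX]
    linarith
  have h2 := abs_le_of_sq_le_sq h1 (by positivity)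
  rwa [abs_of_nonneg (by positivity)] at h2

/-- **THE FIBRE BOUND**: `#fibre X c d ≤ 2 ⌊2√X / √(c² + d²)⌋₊ + 1`. -/
theorem fibre_card_le {X : ℝ} (hX : 0 ≤ X) {c d : ℤ} (hcd : (c, d) ≠ (0, 0)) :
    (fibre X c d).card ≤ 2 * ⌊2 * Real.sqrt X / Real.sqrt (((c : ℤ) : ℝ) ^ 2 + ((d : ℤ) : ℝ) ^ 2)⌋₊ + 1 := by
  rcases (fibre X c d).eq_empty_or_nonempty with h | ⟨⟨a₀, b₀⟩, h₀⟩
  · rw [h, card_empty]; omega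
  set L := ⌊2 * Real.sqrt X / Real.sqrt (((c : ℤ) : ℝ) ^ 2 + ((d : ℤ) : ℝ) ^ 2)⌋₊ with hL
  have hmaps : ∀ p ∈ fibre X c d, tOf c d a₀ b₀ p ∈ Icc (-(L : ℤ)) L := by
    intro p hp
    have := natAbs_tOf_le hX hcd h₀ hp
    rw [mem_Icc]; omega
  have hinj : Set.InjOn (tOf c d a₀ b₀) (fibre X c d : Set (ℤ × ℤ)) := by
    intro p hp q hq hpq
    have hp' := (mem_fibre.1 hp).1
    have hq' := (mem_fibre.1 hq).1
    have h₀' := (mem_fibre.1 h₀).1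
    obtain ⟨hpa, hpb⟩ := eq_progression (c := c) (d := d) h₀' hp'
    obtain ⟨hqa, hqb⟩ := eq_progression (c := c) (d := d) h₀' hq'
    apply Prod.ext
    · linear_combination hpa - hqa + (hpq ▸ rfl : tOf c d a₀ b₀ p * c = tOf c d a₀ b₀ q * c)
    · linear_combination hpb - hqb + (hpq ▸ rfl : tOf c d a₀ b₀ p * d = tOf c d a₀ b₀ q * d)
  calc (fibre X c d).card ≤ (Icc (-(L : ℤ)) L).card := card_le_card_of_injOn _ hmaps hinj
    _ = 2 * L + 1 := by rw [Int.card_Icc]; omega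

/-! ## 2. The shell sum: `Σ_{0 < max(|c|,|d|) ≤ M} 1/√(c² + d²) ≤ 8M` -/

/-- the sup-norm `max(|c|, |d|)` of a lattice point. -/
def supn (p : ℤ × ℤ) : ℕ := max p.1.natAbs p.2.natAbs

/-- the punctured square `[−M, M]² ∖ {0}`. -/
noncomputable def psq (M : ℕ) : Finset (ℤ × ℤ) := (sq M).erase (0, 0)

/-- `supn p ≤ m ↔ p ∈ sq m`. -/
theorem mem_sq_iff_supn_le {m : ℕ} {p : ℤ × ℤ} : p ∈ sq m ↔ supn p ≤ m := by
  simp only [sq, mem_product, mem_Icc, supn, max_le_iff]; omega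

/-- `sq` is monotone. -/
theorem sq_mono {m n : ℕ} (h : m ≤ n) : sq m ⊆ sq n := by
  intro p hp; rw [mem_sq_iff_supn_le] at hp ⊢; omega

/-- the shell `{supn = m}` has at most `8m` points (`m ≥ 1`). -/
theorem card_shell_le (M m : ℕ) (hm : 1 ≤ m) : ((psq M).filter (fun p => supn p = m)).card ≤ 8 * m := by
  have hsub : (psq M).filter (fun p => supn p = m) ⊆ (sq m) \ (sq (m - 1)) := by
    intro p hp
    rw [mem_filter] at hp
    rw [mem_sdiff, mem_sq_iff_supn_le, mem_sq_iff_supn_le]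
    omega
  calc ((psq M).filter (fun p => supn p = m)).card ≤ ((sq m) \ (sq (m - 1))).card := card_le_card hsub
    _ = (sq m).card - (sq (m - 1)).card := card_sdiff_of_subset (sq_mono (by omega))
    _ = (2 * m + 1) ^ 2 - (2 * (m - 1) + 1) ^ 2 := by rw [card_sq, card_sq]
    _ ≤ 8 * m := by
        obtain ⟨k, rfl⟩ : ∃ k, m = k + 1 := ⟨m - 1, by omega⟩
        simp only [Nat.add_sub_cancel]
        have : (2 * (k + 1) + 1) ^ 2 = (2 * k + 1) ^ 2 + 8 * (k + 1) := by ring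
        omega

/-- `1/√(c² + d²) ≤ 1/supn` for a non-zero lattice point. -/
theorem inv_sqrt_le_inv_supn {p : ℤ × ℤ} (hp : p ≠ (0, 0)) :
    (1 : ℝ) / Real.sqrt (((p.1 : ℤ) : ℝ) ^ 2 + ((p.2 : ℤ) : ℝ) ^ 2) ≤ 1 / (supn p : ℝ) := by
  have h1 : 1 ≤ supn p := by
    by_contra h
    have h0 : supn p = 0 := by omega
    simp only [supn, Nat.max_eq_zero_iff, Int.natAbs_eq_zero] at h0
    exact hp (Prod.ext h0.1 h0.2)
  have hpos : (0 : ℝ) < supn p := by exact_mod_cast h1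
  -- `supn p ≤ √(c² + d²)`: `(supn p)² ≤ c² + d²`
  have hsq : ((supn p : ℕ) : ℝ) ^ 2 ≤ ((p.1 : ℤ) : ℝ) ^ 2 + ((p.2 : ℤ) : ℝ) ^ 2 := by
    have e1 : ((p.1.natAbs : ℕ) : ℝ) ^ 2 = ((p.1 : ℤ) : ℝ) ^ 2 := by
      rw [Nat.cast_natAbs, Int.cast_abs, sq_abs]
    have e2 : ((p.2.natAbs : ℕ) : ℝ) ^ 2 = ((p.2 : ℤ) : ℝ) ^ 2 := by
      rw [Nat.cast_natAbs, Int.cast_abs, sq_abs]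
    rcases le_total p.1.natAbs p.2.natAbs with h | h
    · have : supn p = p.2.natAbs := max_eq_right h
      rw [this, e2]; nlinarith [sq_nonneg ((p.1 : ℤ) : ℝ)]
    · have : supn p = p.1.natAbs := max_eq_left h
      rw [this, e1]; nlinarith [sq_nonneg ((p.2 : ℤ) : ℝ)]
  have hle : ((supn p : ℕ) : ℝ) ≤ Real.sqrt (((p.1 : ℤ) : ℝ) ^ 2 + ((p.2 : ℤ) : ℝ) ^ 2) :=
    Real.le_sqrt_of_sq_le hsq
  exact one_div_le_one_div_of_le hpos hle

/-- **THE SHELL SUM**: `Σ_{p ∈ psq M} 1/√(p₁² + p₂²) ≤ 8M`. -/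
theorem sum_inv_sqrt_le (M : ℕ) :
    ∑ p ∈ psq M, (1 : ℝ) / Real.sqrt (((p.1 : ℤ) : ℝ) ^ 2 + ((p.2 : ℤ) : ℝ) ^ 2) ≤ 8 * M := by
  have hmaps : ∀ p ∈ psq M, supn p ∈ Icc 1 M := by
    intro p hp
    rw [psq, mem_erase] at hp
    have h2 : supn p ≤ M := mem_sq_iff_supn_le.1 hp.2
    have h1 : 1 ≤ supn p := by
      by_contra h
      have h0 : supn p = 0 := by omega
      simp only [supn, Nat.max_eq_zero_iff, Int.natAbs_eq_zero] at h0
      exact hp.1 (Prod.ext h0.1 h0.2)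
    exact mem_Icc.2 ⟨h1, h2⟩
  rw [← sum_fiberwise_of_maps_to hmaps]
  calc ∑ m ∈ Icc 1 M, ∑ p ∈ (psq M).filter (fun p => supn p = m),
        (1 : ℝ) / Real.sqrt (((p.1 : ℤ) : ℝ) ^ 2 + ((p.2 : ℤ) : ℝ) ^ 2)
      ≤ ∑ m ∈ Icc 1 M, ∑ p ∈ (psq M).filter (fun p => supn p = m), (1 : ℝ) / (m : ℝ) := by
        apply sum_le_sum
        intro m hm
        apply sum_le_sum
        intro p hp
        rw [mem_filter] at hp
        have hp0 : p ≠ (0, 0) := (mem_erase.1 hp.1).1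
        have := inv_sqrt_le_inv_supn hp0
        rw [hp.2] at this
        exact this
    _ = ∑ m ∈ Icc 1 M, (((psq M).filter (fun p => supn p = m)).card : ℝ) * (1 / (m : ℝ)) := by
        apply sum_congr rfl
        intro m _
        rw [sum_const, nsmul_eq_mul]
    _ ≤ ∑ m ∈ Icc 1 M, (8 : ℝ) := by
        apply sum_le_sum
        intro m hm
        rw [mem_Icc] at hm
        have hc : (((psq M).filter (fun p => supn p = m)).card : ℝ) ≤ 8 * m := by
          exact_mod_cast card_shell_le M m hm.1
        have hm0 : (0 : ℝ) < m := by exact_mod_cast hm.1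
        calc (((psq M).filter (fun p => supn p = m)).card : ℝ) * (1 / (m : ℝ))
            ≤ (8 * m) * (1 / (m : ℝ)) := by gcongr
          _ = 8 := by field_simp
    _ = 8 * M := by
        rw [sum_const, Nat.card_Icc, nsmul_eq_mul, Nat.add_sub_cancel]
        ring

/-! ## 3. The count of the modular group: `#{γ : a² + b² + c² + d² ≤ X} ≤ 38 (1 + X)` -/

/-- the squared Hilbert–Schmidt norm of `γ ∈ SL(2, ℤ)`, as a real number. -/
def hs (γ : SL(2, ℤ)) : ℝ :=
  ((γ 0 0 : ℤ) : ℝ) ^ 2 + ((γ 0 1 : ℤ) : ℝ) ^ 2 + ((γ 1 0 : ℤ) : ℝ) ^ 2 + ((γ 1 1 : ℤ) : ℝ) ^ 2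

/-- `κ` of the real image is `hs / 2`. -/
theorem κ_eq_hs (γ : SL(2, ℤ)) : κ (γ : SL(2, ℝ)) = hs γ / 2 := κ_coe γ

/-- `ad − bc = 1` for `γ ∈ SL(2, ℤ)`. -/
theorem det_entries_int (γ : SL(2, ℤ)) : γ 0 0 * γ 1 1 - γ 0 1 * γ 1 0 = 1 := by
  have := γ.det_coe
  rw [Matrix.det_fin_two] at this
  exact this

/-- the set of `γ` with `hs γ ≤ X` is finite (it lies in a box). -/
theorem finite_hs_le (X : ℝ) : Set.Finite {γ : SL(2, ℤ) | hs γ ≤ X} := by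
  set M : ℕ := ⌊Real.sqrt X⌋₊ with hM
  apply Set.Finite.subset ((box M).finite_toSet.preimage entries_injective.injOn)
  intro γ hγ
  simp only [Set.mem_setOf_eq, hs] at hγ
  simp only [Set.mem_preimage, Finset.mem_coe]
  apply mem_box_of_natAbs_le <;> simp only [entries] <;> apply natAbs_le_floor_sqrt <;>
    nlinarith [sq_nonneg ((γ 0 0 : ℤ) : ℝ), sq_nonneg ((γ 0 1 : ℤ) : ℝ), sq_nonneg ((γ 1 0 : ℤ) : ℝ),
      sq_nonneg ((γ 1 1 : ℤ) : ℝ)]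

/-- the finset of `γ ∈ SL(2, ℤ)` with `hs γ ≤ X`. -/
noncomputable def T (X : ℝ) : Finset SL(2, ℤ) := (finite_hs_le X).toFinset

/-- membership in `T X`. -/
theorem mem_T {X : ℝ} {γ : SL(2, ℤ)} : γ ∈ T X ↔ hs γ ≤ X := by
  simp only [T, Set.Finite.mem_toFinset, Set.mem_setOf_eq]

/-- the bottom row of `γ ∈ T X` lies in the punctured square of radius `⌊√X⌋₊`. -/
theorem bottom_mem_psq {X : ℝ} {γ : SL(2, ℤ)} (hγ : γ ∈ T X) : (γ 1 0, γ 1 1) ∈ psq ⌊Real.sqrt X⌋₊ := by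
  rw [mem_T, hs] at hγ
  rw [psq, mem_erase]
  constructor
  · intro h
    have hdet := det_entries_int γ
    simp only [Prod.mk.injEq] at h
    rw [h.1, h.2] at hdet; simp at hdet
  · apply mem_sq <;> simp only <;> apply natAbs_le_floor_sqrt <;>
      nlinarith [sq_nonneg ((γ 0 0 : ℤ) : ℝ), sq_nonneg ((γ 0 1 : ℤ) : ℝ), sq_nonneg ((γ 1 0 : ℤ) : ℝ),
        sq_nonneg ((γ 1 1 : ℤ) : ℝ)]

/-- the fibre of `T X` over a bottom row `q` injects (by the top row) into `fibre X q.1 q.2`. -/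
theorem card_fibre_T_le {X : ℝ} (q : ℤ × ℤ) :
    ((T X).filter (fun γ => (γ 1 0, γ 1 1) = q)).card ≤ (fibre X q.1 q.2).card := by
  apply card_le_card_of_injOn (fun γ => (γ 0 0, γ 0 1))
  · intro γ hγ
    rw [Finset.mem_coe, mem_filter] at hγ
    obtain ⟨hT, hq⟩ := hγ
    rw [mem_T, hs] at hT
    have hq1 : γ 1 0 = q.1 := congrArg Prod.fst hq
    have hq2 : γ 1 1 = q.2 := congrArg Prod.snd hq
    rw [Finset.mem_coe, mem_fibre]
    constructor
    · change γ 0 0 * q.2 - γ 0 1 * q.1 = 1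
      rw [← hq1, ← hq2]; exact det_entries_int γ
    · change ((γ 0 0 : ℤ) : ℝ) ^ 2 + ((γ 0 1 : ℤ) : ℝ) ^ 2 ≤ X
      nlinarith [sq_nonneg ((γ 1 0 : ℤ) : ℝ), sq_nonneg ((γ 1 1 : ℤ) : ℝ)]
  · intro γ hγ δ hδ h
    simp only [coe_filter, Set.mem_setOf_eq] at hγ hδ
    simp only [Prod.mk.injEq] at h
    apply Matrix.SpecialLinearGroup.ext
    intro i j
    have hb : (γ 1 0, γ 1 1) = (δ 1 0, δ 1 1) := hγ.2.trans hδ.2.symm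
    simp only [Prod.mk.injEq] at hb
    fin_cases i <;> fin_cases j <;> simp only [Fin.zero_eta, Fin.mk_one] <;> tauto

/-- `(2⌊y⌋₊ + 1 : ℝ) ≤ 2y + 1` for `y ≥ 0`. -/
theorem two_floor_add_one_le {y : ℝ} (hy : 0 ≤ y) : ((2 * ⌊y⌋₊ + 1 : ℕ) : ℝ) ≤ 2 * y + 1 := by
  have := Nat.floor_le hy
  push_cast; linarith

/-- **THE SHARP COUNT**: `#{γ ∈ SL(2, ℤ) : a² + b² + c² + d² ≤ X} ≤ 38 (1 + X)`. -/
theorem card_T_le (X : ℝ) (hX : 0 ≤ X) : ((T X).card : ℝ) ≤ 38 * (1 + X) := by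
  set M : ℕ := ⌊Real.sqrt X⌋₊ with hM
  have hmaps : ∀ γ ∈ T X, (γ 1 0, γ 1 1) ∈ psq M := fun γ hγ => bottom_mem_psq hγ
  rw [card_eq_sum_card_fiberwise hmaps]
  have ht0 : 0 ≤ Real.sqrt X := Real.sqrt_nonneg _
  have ht2 : Real.sqrt X ^ 2 = X := Real.sq_sqrt hX; have hMle : (M : ℝ) ≤ Real.sqrt X := Nat.floor_le ht0
  -- each fibre is at most `4√X/√(c² + d²) + 1`
  have hfib : ∀ q ∈ psq M, ((((T X).filter (fun γ => (γ 1 0, γ 1 1) = q)).card : ℕ) : ℝ) ≤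
      4 * Real.sqrt X * (1 / Real.sqrt (((q.1 : ℤ) : ℝ) ^ 2 + ((q.2 : ℤ) : ℝ) ^ 2)) + 1 := by
    intro q hq
    have hq0 : q ≠ (0, 0) := (mem_erase.1 hq).1
    have hq0' : (q.1, q.2) ≠ (0, 0) := by simpa using hq0
    have h1 := card_fibre_T_le (X := X) q
    have h2 := fibre_card_le hX hq0'
    have h3 := two_floor_add_one_le (y := 2 * Real.sqrt X / Real.sqrt (((q.1 : ℤ) : ℝ) ^ 2 + ((q.2 : ℤ) : ℝ) ^ 2))
      (by positivity)
    calc ((((T X).filter (fun γ => (γ 1 0, γ 1 1) = q)).card : ℕ) : ℝ)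
        ≤ ((2 * ⌊2 * Real.sqrt X / Real.sqrt (((q.1 : ℤ) : ℝ) ^ 2 + ((q.2 : ℤ) : ℝ) ^ 2)⌋₊ + 1 : ℕ) : ℝ) := by
          exact_mod_cast le_trans h1 h2
      _ ≤ 2 * (2 * Real.sqrt X / Real.sqrt (((q.1 : ℤ) : ℝ) ^ 2 + ((q.2 : ℤ) : ℝ) ^ 2)) + 1 := h3
      _ = 4 * Real.sqrt X * (1 / Real.sqrt (((q.1 : ℤ) : ℝ) ^ 2 + ((q.2 : ℤ) : ℝ) ^ 2)) + 1 := by ring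
  calc ((∑ q ∈ psq M, ((T X).filter (fun γ => (γ 1 0, γ 1 1) = q)).card : ℕ) : ℝ)
      = ∑ q ∈ psq M, ((((T X).filter (fun γ => (γ 1 0, γ 1 1) = q)).card : ℕ) : ℝ) := by push_cast; rfl
    _ ≤ ∑ q ∈ psq M, (4 * Real.sqrt X * (1 / Real.sqrt (((q.1 : ℤ) : ℝ) ^ 2 + ((q.2 : ℤ) : ℝ) ^ 2)) + 1) :=
        sum_le_sum hfib
    _ = 4 * Real.sqrt X * ∑ q ∈ psq M, (1 / Real.sqrt (((q.1 : ℤ) : ℝ) ^ 2 + ((q.2 : ℤ) : ℝ) ^ 2)) +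
          ((psq M).card : ℝ) := by
        rw [sum_add_distrib, ← mul_sum, sum_const, nsmul_eq_mul, mul_one]
    _ ≤ 4 * Real.sqrt X * (8 * M) + ((2 * M + 1) ^ 2 : ℕ) := by
        gcongr
        · exact sum_inv_sqrt_le M
        · exact_mod_cast (card_le_card (erase_subset _ _)).trans (card_sq M).le
    _ ≤ 32 * X + (2 * Real.sqrt X + 1) ^ 2 := by
        have hA : 4 * Real.sqrt X * (8 * (M : ℝ)) ≤ 32 * X := by
          nlinarith [mul_le_mul_of_nonneg_left hMle ht0, ht2]
        have hB : (2 * (M : ℝ) + 1) ^ 2 ≤ (2 * Real.sqrt X + 1) ^ 2 :=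
          pow_le_pow_left₀ (by positivity) (by linarith) 2
        push_cast
        linarith [hA, hB]
    _ ≤ 38 * (1 + X) := by nlinarith [sq_nonneg (Real.sqrt X - 1)]

/-! ## 4. The consequences: `β = 1` and the Poincaré series for every `α > 1` -/

/-- **THE MODULAR GROUP'S SHARP COUNT IN THE COSH-SIZE**: `#{γ ∈ SL(2, ℤ) : κ γ ≤ R} ≤ 76 (1 + R)` — `β = 1`. -/
theorem count_SL2Z_sharp (R : ℝ) (hR : 0 ≤ R) :
    ∃ s : Finset SL(2, ℤ), (∀ γ : SL(2, ℤ), κ (γ : SL(2, ℝ)) ≤ R → γ ∈ s) ∧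
      (s.card : ℝ) ≤ 76 * (1 + R) ^ (1 : ℝ) := by
  refine ⟨T (2 * R), fun γ hγ => ?_, ?_⟩
  · rw [mem_T]; rw [κ_eq_hs] at hγ; linarith
  · rw [Real.rpow_one]
    have := card_T_le (2 * R) (by linarith)
    linarith

variable (f : SL(2, ℝ) → ℂ)

/-- absolute convergence of the Poincaré series of `SL(2, ℤ)` for EVERY decay exponent `α > 1`. -/
theorem summable_norm_kernel_SL2Z' {α : ℝ} (hα : 1 < α) {C : ℝ}
    (hf : ∀ g, ‖f g‖ ≤ C * (1 + κ g) ^ (-α)) (x y : SL(2, ℝ)) :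
    Summable fun γ : SL(2, ℤ) => ‖f (x⁻¹ * ιZ γ * y)‖ :=
  summable_norm_kernel_SL2 ιZ f (β := 1) zero_le_one hα (C' := 76) count_SL2Z_sharp hf x y

/-- **THE POINCARÉ-SERIES KERNEL OF THE MODULAR GROUP IS CONTINUOUS FOR EVERY `α > 1`** (weight 3: `α = 3/2`, route (R1)). -/
theorem continuous_kernelSum_SL2Z' (hfc : Continuous f) {α : ℝ} (hα : 1 < α) {C : ℝ}
    (hf : ∀ g, ‖f g‖ ≤ C * (1 + κ g) ^ (-α)) :
    Continuous (fun p : SL(2, ℝ) × SL(2, ℝ) => PoincareKernel.kernelSum ιZ f p.1 p.2) :=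
  continuous_kernelSum_SL2 ιZ f hfc (β := 1) zero_le_one hα (C' := 76) count_SL2Z_sharp hf

end Summit.Ventures.HodgeRepro2.Tier7.Line3.ModularGroupCount
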